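import Mathlib.NumberTheory.Harmonic.Bounds
import Mathlib.Analysis.Complex.ExponentialBounds
import Literature.NumberTheory.LFunctions.GaussianHeckeMoebius
import Literature.NumberTheory.LFunctions.GaussianHeckePrimeSums
import Literature.NumberTheory.LFunctions.GaussianHeckeMeanValue
import HarnessLib

/-!
# Divisor-class moments over `ℤ[i]*`: `∑_{N(v) ≤ y} τ⋆(v)² ≪ y log³ y` and companions

Topic `Literature/NumberTheory/LFunctions`, elementary lattice-point/divisor estimates over the Gaussian
integers needed (with at most logarithmic losses — the zero-density estimate
`GaussianHecke.ricci_zeroDensity` allows only powers of `log K`) by the class-I and class-II counts of the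
zero-detection method for `D_m = 4 L(·, λ^m)`.  `τ⋆(v) = #divisorsStar v` is the number of divisor
CLASSES of `v` (`GaussianHeckeMoebius.lean`), `g(v) = gcd(re v, im v)` its content
(`GaussianInt.content`).  Everything is PROVED; no definitions, no named facts.

* `card_normLEStar_le` — `#{v ∈ ℤ[i]* : N(v) ≤ R} ≤ 9R` (`R ≥ 0`);
* `sum_inv_norm_le` — `∑_{v ∈ ℤ[i]*, N(v) ≤ y} 1/N(v) ≤ 44 (1 + log y)` (`y ≥ 1`; dyadic shells);
* `card_filter_dvd_le`, `card_filter_dvd_dvd_le` — multiples: `#{N(v) ≤ R : L ∣ v} ≤ 9R/N(L)` and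
  `#{N(v) ≤ R : d₁ ∣ v, d₂ ∣ v} ≤ 9R N(gcd)/(N(d₁)N(d₂))` (Bézout in the Euclidean domain `ℤ[i]`:
  `d₂ ∣ d₁ w ⇒ (d₂/gcd) ∣ w`);
* `card_divisorsStar_mul_le` — **`τ⋆(ab) ≤ τ⋆(a) τ⋆(b)`**;
* `sum_card_divisorsStar_sq_le` — **the second moment `∑_{N(v) ≤ y} τ⋆(v)² ≤ 10⁷ y (1 + log y)³`**
  (count triples `(v, d₁, d₂)`; sum over the pair first; `N(gcd) ≤ ∑_{h ∣ d₁, d₂} N(h)`;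
  `∑_{h} N(h)(∑_{h ∣ d} N(d)⁻¹)² ≤ (∑ N(w)⁻¹)³`);
* `sum_content_le` — **`∑_{N(v) ≤ y} g(v) ≤ 9 y (1 + log y)`** (`#{content = e} ≤ 9y/e²`).

## References

* G. H. Hardy, E. M. Wright, *An Introduction to the Theory of Numbers*, §18.2 (the model `∑ d(n)² ≍ x log³x`
  over `ℤ`); the Gaussian statements are [folklore].
-/

noncomputable section

open Finset UniqueFactorizationMonoid

namespace Literature.NumberTheory.LFunctions

namespace GaussianHecke

open GaussianInt GaussianTheta

open scoped Classical

/-! ### Lattice points of `ℤ[i]*` in a disc -/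

/-- `#{v ∈ ℤ[i]* : N(v) ≤ R} ≤ 9R` for every real `R ≥ 0` (for `R < 1` the set is empty). [folklore] -/
theorem card_normLEStar_le {R : ℝ} (hR : 0 ≤ R) : ((normLEStar R).card : ℝ) ≤ 9 * R := by
  rcases lt_or_ge R 1 with h1 | h1
  · have he : normLEStar R = ∅ := by
      ext v
      simp only [mem_normLEStar, Finset.notMem_empty, iff_false, not_and]
      intro hv hq
      have := norm_pos_of_mem_firstQuadrant hq
      have : (1 : ℝ) ≤ v.norm := by exact_mod_cast this
      linarith
    rw [he, card_empty, Nat.cast_zero]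
    linarith
  · have hsub : normLEStar R ⊆ normLE ((⌊R⌋₊ : ℕ) : ℝ) := by
      intro v hv
      rw [mem_normLEStar] at hv
      rw [mem_normLE]
      have h0 : 0 ≤ v.norm := GaussianInt.norm_nonneg v
      have : v.norm.toNat ≤ ⌊R⌋₊ := Nat.le_floor (by
        have : ((v.norm.toNat : ℕ) : ℝ) = (v.norm : ℝ) := by exact_mod_cast Int.toNat_of_nonneg h0
        rw [this]; exact hv.1)
      have h2 : (v.norm : ℝ) = ((v.norm.toNat : ℕ) : ℝ) := by exact_mod_cast (Int.toNat_of_nonneg h0).symm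
      rw [h2]; exact_mod_cast this
    have hM : 1 ≤ ⌊R⌋₊ := Nat.le_floor (by exact_mod_cast h1)
    calc ((normLEStar R).card : ℝ) ≤ (normLE ((⌊R⌋₊ : ℕ) : ℝ)).card := by exact_mod_cast card_le_card hsub
      _ ≤ 9 * (⌊R⌋₊ : ℝ) := card_normLE_le_nine_mul hM
      _ ≤ 9 * R := by gcongr; exact Nat.floor_le hR

/-! ### `∑ 1/N(v)` -/

/-- Dyadic shell bound: `∑_{v ∈ ℤ[i]*, 2^j ≤ N(v) < 2^{j+1}} N(v)⁻¹ ≤ 18`. [folklore] -/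
theorem sum_inv_norm_shell_le (y : ℝ) (j : ℕ) :
    ∑ v ∈ (normLEStar y).filter (fun v ↦ Nat.log 2 v.norm.toNat = j), ((v.norm : ℝ))⁻¹ ≤ 18 := by
  have hsub : (normLEStar y).filter (fun v ↦ Nat.log 2 v.norm.toNat = j) ⊆ normLEStar ((2 : ℝ) ^ (j + 1)) := by
    intro v hv
    rw [mem_filter, mem_normLEStar] at hv
    rw [mem_normLEStar]
    refine ⟨?_, hv.1.2⟩
    have h0 : 0 ≤ v.norm := GaussianInt.norm_nonneg v
    have hlt : v.norm.toNat < 2 ^ (j + 1) := by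
      have := Nat.lt_pow_succ_log_self (b := 2) (by norm_num) v.norm.toNat
      rw [hv.2] at this; exact this
    have : (v.norm : ℝ) = ((v.norm.toNat : ℕ) : ℝ) := by exact_mod_cast (Int.toNat_of_nonneg h0).symm
    rw [this]; exact_mod_cast hlt.le
  have hterm : ∀ v ∈ (normLEStar y).filter (fun v ↦ Nat.log 2 v.norm.toNat = j),
      ((v.norm : ℝ))⁻¹ ≤ ((2 : ℝ) ^ j)⁻¹ := by
    intro v hv
    rw [mem_filter, mem_normLEStar] at hv
    have hpos := norm_pos_of_mem_firstQuadrant hv.1.2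
    have h0 : 0 ≤ v.norm := hpos.le
    have hge : 2 ^ j ≤ v.norm.toNat := by
      have hne : v.norm.toNat ≠ 0 := by omega
      have := Nat.pow_log_le_self 2 hne
      rw [hv.2] at this; exact this
    have h2 : ((2 : ℝ) ^ j) ≤ (v.norm : ℝ) := by
      have : (v.norm : ℝ) = ((v.norm.toNat : ℕ) : ℝ) := by exact_mod_cast (Int.toNat_of_nonneg h0).symm
      rw [this]; exact_mod_cast hge
    exact inv_anti₀ (by positivity) h2
  calc ∑ v ∈ (normLEStar y).filter (fun v ↦ Nat.log 2 v.norm.toNat = j), ((v.norm : ℝ))⁻¹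
      ≤ ∑ v ∈ (normLEStar y).filter (fun v ↦ Nat.log 2 v.norm.toNat = j), ((2 : ℝ) ^ j)⁻¹ := sum_le_sum hterm
    _ = ((normLEStar y).filter (fun v ↦ Nat.log 2 v.norm.toNat = j)).card * ((2 : ℝ) ^ j)⁻¹ := by
        rw [sum_const, nsmul_eq_mul]
    _ ≤ (9 * (2 : ℝ) ^ (j + 1)) * ((2 : ℝ) ^ j)⁻¹ := by
        gcongr
        exact le_trans (by exact_mod_cast card_le_card hsub) (card_normLEStar_le (by positivity))
    _ = 18 := by rw [pow_succ]; field_simp; ring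

/-- **`∑_{v ∈ ℤ[i]*, N(v) ≤ y} 1/N(v) ≤ 44 (1 + log y)`** for `y ≥ 1` (`18` per dyadic shell,
`⌊log₂ y⌋ + 1 ≤ 1 + log y/log 2` shells). [folklore] -/
theorem sum_inv_norm_le {y : ℝ} (hy : 1 ≤ y) :
    ∑ v ∈ normLEStar y, ((v.norm : ℝ))⁻¹ ≤ 44 * (1 + Real.log y) := by
  set J : ℕ := Nat.log 2 ⌊y⌋₊ with hJ
  have hmaps : ∀ v ∈ normLEStar y, Nat.log 2 v.norm.toNat ∈ range (J + 1) := by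
    intro v hv
    rw [mem_normLEStar] at hv
    rw [mem_range, Nat.lt_succ_iff, hJ]
    refine Nat.log_mono_right ?_
    have h0 : 0 ≤ v.norm := GaussianInt.norm_nonneg v
    refine Nat.le_floor ?_
    have : ((v.norm.toNat : ℕ) : ℝ) = (v.norm : ℝ) := by exact_mod_cast Int.toNat_of_nonneg h0
    rw [this]; exact hv.1
  rw [← sum_fiberwise_of_maps_to hmaps]
  have hlog : (J : ℝ) ≤ Real.log y / Real.log 2 := by
    rw [le_div_iff₀ (Real.log_pos one_lt_two), ← Real.log_pow]
    refine Real.log_le_log (by positivity) ?_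
    have h1 : (2 : ℕ) ^ J ≤ ⌊y⌋₊ := by
      rw [hJ]; exact Nat.pow_log_le_self 2 (Nat.pos_iff_ne_zero.1 (Nat.floor_pos.2 hy))
    calc ((2 : ℝ)) ^ J = ((2 ^ J : ℕ) : ℝ) := by push_cast; ring
      _ ≤ (⌊y⌋₊ : ℝ) := by exact_mod_cast h1
      _ ≤ y := Nat.floor_le (by linarith)
  have hlog2 : Real.log 2 > 0.6931471803 := Real.log_two_gt_d9
  have hly : 0 ≤ Real.log y := Real.log_nonneg hy
  calc ∑ j ∈ range (J + 1), ∑ v ∈ (normLEStar y).filter (fun v ↦ Nat.log 2 v.norm.toNat = j), ((v.norm : ℝ))⁻¹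
      ≤ ∑ j ∈ range (J + 1), (18 : ℝ) := sum_le_sum fun j _ ↦ sum_inv_norm_shell_le y j
    _ = 18 * (J + 1) := by rw [sum_const, card_range, nsmul_eq_mul]; push_cast; ring
    _ ≤ 18 * (Real.log y / Real.log 2 + 1) := by gcongr
    _ ≤ 44 * (1 + Real.log y) := by
        have : Real.log y / Real.log 2 ≤ 2 * Real.log y := by
          rw [div_le_iff₀ (by linarith)]; nlinarith
        linarith

/-! ### Counting multiples -/

/-- **Multiples of `L` in a disc:** `#{v ∈ ℤ[i]*, N(v) ≤ R : L ∣ v} ≤ 9R/N(L)` (`L ≠ 0`, `R ≥ 0`;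
`v ↦ q1(v/L)` is injective into the disc of radius `R/N(L)`). [folklore] -/
theorem card_filter_dvd_le {L : _root_.GaussianInt} (hL : L ≠ 0) {R : ℝ} (hR : 0 ≤ R) :
    (((normLEStar R).filter (fun v ↦ L ∣ v)).card : ℝ) ≤ 9 * R / (L.norm : ℝ) := by
  have hNL : (0 : ℝ) < (L.norm : ℝ) := by exact_mod_cast GaussianInt.norm_pos.2 hL
  rw [le_div_iff₀ hNL]
  -- injection into `normLEStar (R / N(L))`
  have hcard : ((normLEStar R).filter (fun v ↦ L ∣ v)).card ≤ (normLEStar (R / (L.norm : ℝ))).card := by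
    refine card_le_card_of_injOn (fun v ↦ q1 (v / L)) ?_ ?_
    · intro v hv
      rw [mem_coe, mem_filter, mem_normLEStar] at hv
      obtain ⟨⟨hvR, hvq⟩, hdvd⟩ := hv
      have hv0 : v ≠ 0 := ne_zero_of_mem_fq hvq
      have hvL : L * (v / L) = v := EuclideanDomain.mul_div_cancel' hL hdvd
      have hw0 : v / L ≠ 0 := by intro h; rw [h, mul_zero] at hvL; exact hv0 hvL.symm
      rw [mem_coe, mem_normLEStar]
      refine ⟨?_, q1_mem hw0⟩
      rw [norm_q1, le_div_iff₀ hNL]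
      have : (L.norm : ℝ) * ((v / L).norm : ℝ) = (v.norm : ℝ) := by
        rw [← Int.cast_mul, ← Zsqrtd.norm_mul, hvL]
      nlinarith
    · intro v hv v' hv' heq
      rw [mem_coe, mem_filter, mem_normLEStar] at hv hv'
      have h1 : L * (v / L) = v := EuclideanDomain.mul_div_cancel' hL hv.2
      have h2 : L * (v' / L) = v' := EuclideanDomain.mul_div_cancel' hL hv'.2
      have hw0 : v / L ≠ 0 := by
        intro h; rw [h, mul_zero] at h1; exact ne_zero_of_mem_fq hv.1.2 h1.symm
      have hassoc : Associated (v / L) (v' / L) :=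
        ((associated_q1 _).symm.trans (by rw [show q1 (v / L) = q1 (v' / L) from heq])).trans (associated_q1 _)
      have hassoc' : Associated v v' := by
        rw [← h1, ← h2]; exact hassoc.mul_left L
      exact eq_of_associated hassoc' hv.1.2 hv'.1.2
  calc (((normLEStar R).filter (fun v ↦ L ∣ v)).card : ℝ) * (L.norm : ℝ)
      ≤ (normLEStar (R / (L.norm : ℝ))).card * (L.norm : ℝ) := by gcongr
    _ ≤ 9 * (R / (L.norm : ℝ)) * (L.norm : ℝ) := by
        gcongr; exact card_normLEStar_le (div_nonneg hR hNL.le)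
    _ = 9 * R := by field_simp

/-- Bézout in `ℤ[i]`: if `d₂ ∣ d₁ w` then `d₂ / gcd(d₁, d₂) ∣ w` (`d₁, d₂` not both zero). [folklore] -/
theorem div_gcd_dvd_of_dvd_mul {d₁ d₂ w : _root_.GaussianInt} (hg : EuclideanDomain.gcd d₁ d₂ ≠ 0)
    (h : d₂ ∣ d₁ * w) : d₂ / EuclideanDomain.gcd d₁ d₂ ∣ w := by
  set g := EuclideanDomain.gcd d₁ d₂ with hgdef
  have hbez := EuclideanDomain.gcd_eq_gcd_ab d₁ d₂
  -- `d₂ ∣ g w`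
  have h1 : d₂ ∣ g * w := by
    rw [hgdef, hbez, add_mul, mul_assoc, mul_assoc, mul_comm (EuclideanDomain.gcdA d₁ d₂) w,
      mul_comm (EuclideanDomain.gcdB d₁ d₂) w, ← mul_assoc, ← mul_assoc]
    exact dvd_add (h.mul_right _) ((dvd_mul_right d₂ w).mul_right _)
  have hgd : g * (d₂ / g) = d₂ := EuclideanDomain.mul_div_cancel' hg (EuclideanDomain.gcd_dvd_right d₁ d₂)
  rw [← hgd] at h1
  exact (mul_dvd_mul_iff_left hg).1 h1

/-- **Common multiples of `d₁, d₂` in a disc:** for `d₁, d₂ ≠ 0` and `R ≥ 0`,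
`#{v ∈ ℤ[i]*, N(v) ≤ R : d₁ ∣ v ∧ d₂ ∣ v} ≤ 9 R N(gcd(d₁,d₂)) / (N(d₁) N(d₂))`. [folklore] -/
theorem card_filter_dvd_dvd_le {d₁ d₂ : _root_.GaussianInt} (h₁ : d₁ ≠ 0) (h₂ : d₂ ≠ 0) {R : ℝ} (hR : 0 ≤ R) :
    (((normLEStar R).filter (fun v ↦ d₁ ∣ v ∧ d₂ ∣ v)).card : ℝ) ≤
      9 * R * ((EuclideanDomain.gcd d₁ d₂).norm : ℝ) / ((d₁.norm : ℝ) * (d₂.norm : ℝ)) := by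
  set g := EuclideanDomain.gcd d₁ d₂ with hgdef
  have hg : g ≠ 0 := fun h ↦ h₁ ((EuclideanDomain.gcd_eq_zero_iff.1 h).1)
  set L := d₁ * (d₂ / g) with hLdef
  have hgd : g * (d₂ / g) = d₂ := EuclideanDomain.mul_div_cancel' hg (EuclideanDomain.gcd_dvd_right d₁ d₂)
  have hq0 : d₂ / g ≠ 0 := by intro h; rw [h, mul_zero] at hgd; exact h₂ hgd.symm
  have hL : L ≠ 0 := mul_ne_zero h₁ hq0
  have hN1 : (0 : ℝ) < (d₁.norm : ℝ) := by exact_mod_cast GaussianInt.norm_pos.2 h₁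
  have hN2 : (0 : ℝ) < (d₂.norm : ℝ) := by exact_mod_cast GaussianInt.norm_pos.2 h₂
  have hNg : (0 : ℝ) < (g.norm : ℝ) := by exact_mod_cast GaussianInt.norm_pos.2 hg
  -- `N(L) N(g) = N(d₁) N(d₂)`
  have hq : (g.norm : ℝ) * ((d₂ / g).norm : ℝ) = (d₂.norm : ℝ) := by
    rw [← Int.cast_mul, ← Zsqrtd.norm_mul, hgd]
  have hLn : (L.norm : ℝ) = (d₁.norm : ℝ) * ((d₂ / g).norm : ℝ) := by
    rw [hLdef, Zsqrtd.norm_mul, Int.cast_mul]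
  have hNL : (L.norm : ℝ) * (g.norm : ℝ) = (d₁.norm : ℝ) * (d₂.norm : ℝ) := by
    rw [hLn, ← hq]; ring
  have hsub : (normLEStar R).filter (fun v ↦ d₁ ∣ v ∧ d₂ ∣ v) ⊆ (normLEStar R).filter (fun v ↦ L ∣ v) := by
    intro v hv
    rw [mem_filter] at hv ⊢
    refine ⟨hv.1, ?_⟩
    obtain ⟨w, hw⟩ := hv.2.1
    have h3 : d₂ ∣ d₁ * w := by rw [← hw]; exact hv.2.2
    have h4 := div_gcd_dvd_of_dvd_mul hg h3
    rw [hw, hLdef]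
    exact mul_dvd_mul_left d₁ h4
  calc (((normLEStar R).filter (fun v ↦ d₁ ∣ v ∧ d₂ ∣ v)).card : ℝ)
      ≤ ((normLEStar R).filter (fun v ↦ L ∣ v)).card := by exact_mod_cast card_le_card hsub
    _ ≤ 9 * R / (L.norm : ℝ) := card_filter_dvd_le hL hR
    _ = 9 * R * (g.norm : ℝ) / ((d₁.norm : ℝ) * (d₂.norm : ℝ)) := by
        rw [← hNL]; field_simp

/-! ### Submultiplicativity of `τ⋆` -/

/-- **`τ⋆(ab) ≤ τ⋆(a) τ⋆(b)`** (`a, b ≠ 0`; every divisor class of `ab` is `q1(d₁ d₂)` with `d₁ ∣ a`,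
`d₂ ∣ b`). [folklore] -/
theorem card_divisorsStar_mul_le {a b : _root_.GaussianInt} (ha : a ≠ 0) (hb : b ≠ 0) :
    (divisorsStar (a * b)).card ≤ (divisorsStar a).card * (divisorsStar b).card := by
  rw [divisorsStar_mul ha hb, ← card_product]
  exact card_image_le

/-! ### The second moment of `τ⋆` -/

/-- Exact quotients: for `h ≠ 0`, `h ∣ d`, `d ∈ ℤ[i]*`: `h · (d/h) = d` and `d/h ≠ 0`. [folklore] -/
theorem mul_div_eq_and_ne_zero {h d : _root_.GaussianInt} (hh : h ≠ 0) (hd : d ∈ firstQuadrant)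
    (hdvd : h ∣ d) : h * (d / h) = d ∧ d / h ≠ 0 := by
  have e1 : h * (d / h) = d := EuclideanDomain.mul_div_cancel' hh hdvd
  refine ⟨e1, fun h0 ↦ ?_⟩
  rw [h0, mul_zero] at e1
  exact ne_zero_of_mem_fq hd e1.symm

/-- `d ↦ q1(d/h)` is injective on the multiples of `h ≠ 0` in `ℤ[i]*`. [folklore] -/
theorem injOn_q1_div {h : _root_.GaussianInt} (hh : h ≠ 0) (y : ℝ) :
    Set.InjOn (fun d ↦ q1 (d / h)) ↑((normLEStar y).filter (fun d ↦ h ∣ d)) := by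
  intro d hd d' hd' hdd
  rw [mem_coe, mem_filter, mem_normLEStar] at hd hd'
  obtain ⟨e1, -⟩ := mul_div_eq_and_ne_zero hh hd.1.2 hd.2
  obtain ⟨e2, -⟩ := mul_div_eq_and_ne_zero hh hd'.1.2 hd'.2
  have hdd' : q1 (d / h) = q1 (d' / h) := hdd
  have hassoc : Associated (d / h) (d' / h) := by
    have a1 := (associated_q1 (d / h)).symm
    have a2 := associated_q1 (d' / h)
    rw [hdd'] at a1
    exact a1.trans a2
  have : Associated d d' := by rw [← e1, ← e2]; exact hassoc.mul_left h
  exact eq_of_associated this hd.1.2 hd'.1.2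

/-- The quotients `q1(d/h)` of the multiples `d` of `h` with `N(d) ≤ y` have `N ≤ y` (indeed `≤ y/N(h)`).
[folklore] -/
theorem image_q1_div_subset {h : _root_.GaussianInt} (hh : h ≠ 0) (y : ℝ) :
    ((normLEStar y).filter (fun d ↦ h ∣ d)).image (fun d ↦ q1 (d / h)) ⊆ normLEStar y := by
  intro w hw
  rw [mem_image] at hw
  obtain ⟨d, hd, rfl⟩ := hw
  rw [mem_filter, mem_normLEStar] at hd
  obtain ⟨e1, hq0⟩ := mul_div_eq_and_ne_zero hh hd.1.2 hd.2
  rw [mem_normLEStar, norm_q1]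
  refine ⟨?_, q1_mem hq0⟩
  have hmul : (h.norm : ℝ) * ((d / h).norm : ℝ) = (d.norm : ℝ) := by
    rw [← Int.cast_mul, ← Zsqrtd.norm_mul, e1]
  have h1 : (1 : ℝ) ≤ (h.norm : ℝ) := by exact_mod_cast GaussianInt.norm_pos.2 hh
  have hNq : (0 : ℝ) ≤ ((d / h).norm : ℝ) := by exact_mod_cast GaussianInt.norm_nonneg _
  nlinarith [hd.1.1]

/-- For `h ∈ ℤ[i]*` and `y ≥ 1`: `∑_{d ∈ ℤ[i]*, N(d) ≤ y, h ∣ d} N(d)⁻¹ ≤ 44 (1 + log y) / N(h)`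
(`d = h w`, `N(d) = N(h) N(w)`). [folklore] -/
theorem sum_inv_norm_filter_dvd_le {y : ℝ} (hy : 1 ≤ y) {h : _root_.GaussianInt} (hh : h ≠ 0) :
    ∑ d ∈ (normLEStar y).filter (fun d ↦ h ∣ d), ((d.norm : ℝ))⁻¹ ≤ 44 * (1 + Real.log y) / (h.norm : ℝ) := by
  have hNh : (0 : ℝ) < (h.norm : ℝ) := by exact_mod_cast GaussianInt.norm_pos.2 hh
  rw [le_div_iff₀ hNh, sum_mul]
  have heq : ∀ d ∈ (normLEStar y).filter (fun d ↦ h ∣ d),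
      ((d.norm : ℝ))⁻¹ * (h.norm : ℝ) = (((q1 (d / h)).norm : ℝ))⁻¹ := by
    intro d hd
    rw [mem_filter, mem_normLEStar] at hd
    obtain ⟨e1, hq0⟩ := mul_div_eq_and_ne_zero hh hd.1.2 hd.2
    rw [norm_q1]
    have hmul : (h.norm : ℝ) * ((d / h).norm : ℝ) = (d.norm : ℝ) := by
      rw [← Int.cast_mul, ← Zsqrtd.norm_mul, e1]
    rw [← hmul, mul_inv, mul_comm ((h.norm : ℝ))⁻¹, mul_assoc, inv_mul_cancel₀ hNh.ne', mul_one]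
  calc ∑ d ∈ (normLEStar y).filter (fun d ↦ h ∣ d), ((d.norm : ℝ))⁻¹ * (h.norm : ℝ)
      = ∑ d ∈ (normLEStar y).filter (fun d ↦ h ∣ d), (((q1 (d / h)).norm : ℝ))⁻¹ := sum_congr rfl heq
    _ = ∑ w ∈ ((normLEStar y).filter (fun d ↦ h ∣ d)).image (fun d ↦ q1 (d / h)), ((w.norm : ℝ))⁻¹ :=
        (sum_image (f := fun w : _root_.GaussianInt ↦ ((w.norm : ℝ))⁻¹) (injOn_q1_div hh y)).symm
    _ ≤ ∑ w ∈ normLEStar y, ((w.norm : ℝ))⁻¹ :=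
        sum_le_sum_of_subset_of_nonneg (image_q1_div_subset hh y) fun w _ _ ↦
          inv_nonneg.2 (by exact_mod_cast GaussianInt.norm_nonneg w)
    _ ≤ 44 * (1 + Real.log y) := sum_inv_norm_le hy

/-- A divisor class of `v ∈ ℤ[i]*`, `N(v) ≤ y`, lies in `{N ≤ y}`. [folklore] -/
theorem divisorsStar_subset_normLEStar {y : ℝ} {v : _root_.GaussianInt} (hv : v ∈ normLEStar y) :
    divisorsStar v ⊆ normLEStar y := by
  intro d hd
  rw [mem_normLEStar] at hv ⊢
  have hv0 : v ≠ 0 := ne_zero_of_mem_fq hv.2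
  obtain ⟨hdq, hdv⟩ := (mem_divisorsStar hv0).1 hd
  exact ⟨le_trans (by exact_mod_cast norm_le_norm_of_dvd hdv hv0) hv.1, hdq⟩

/-- **Double counting:** `∑_{N(v) ≤ y} τ⋆(v)² = ∑_{(d₁,d₂)} #{N(v) ≤ y : d₁ ∣ v, d₂ ∣ v}` (pairs in
`{N ≤ y}²`). [folklore] -/
theorem sum_card_divisorsStar_sq_eq (y : ℝ) :
    ∑ v ∈ normLEStar y, ((divisorsStar v).card : ℝ) ^ 2 =
      ∑ p ∈ normLEStar y ×ˢ normLEStar y, ((((normLEStar y).filter (fun v ↦ p.1 ∣ v ∧ p.2 ∣ v)).card : ℕ) : ℝ) := by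
  have h1 : ∀ v ∈ normLEStar y, ((divisorsStar v).card : ℝ) ^ 2 =
      ∑ p ∈ divisorsStar v ×ˢ divisorsStar v, (1 : ℝ) := by
    intro v _
    rw [sum_const, nsmul_eq_mul, mul_one, card_product, Nat.cast_mul, sq]
  rw [sum_congr rfl h1]
  have h2 : ∀ p ∈ normLEStar y ×ˢ normLEStar y,
      ((((normLEStar y).filter (fun v ↦ p.1 ∣ v ∧ p.2 ∣ v)).card : ℝ)) =
        ∑ v ∈ (normLEStar y).filter (fun v ↦ p.1 ∣ v ∧ p.2 ∣ v), (1 : ℝ) := by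
    intro p _
    rw [sum_const, nsmul_eq_mul, mul_one]
  rw [sum_congr rfl h2]
  refine sum_comm' fun v p ↦ ?_
  constructor
  · rintro ⟨hv, hp⟩
    rw [mem_product] at hp
    have hsub := divisorsStar_subset_normLEStar hv
    have hv0 : v ≠ 0 := ne_zero_of_mem_fq (mem_normLEStar.1 hv).2
    refine ⟨mem_filter.2 ⟨hv, ((mem_divisorsStar hv0).1 hp.1).2, ((mem_divisorsStar hv0).1 hp.2).2⟩,
      mem_product.2 ⟨hsub hp.1, hsub hp.2⟩⟩
  · rintro ⟨hv, hp⟩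
    rw [mem_filter] at hv
    rw [mem_product] at hp
    have hv0 : v ≠ 0 := ne_zero_of_mem_fq (mem_normLEStar.1 hv.1).2
    refine ⟨hv.1, mem_product.2 ⟨(mem_divisorsStar hv0).2 ⟨(mem_normLEStar.1 hp.1).2, hv.2.1⟩,
      (mem_divisorsStar hv0).2 ⟨(mem_normLEStar.1 hp.2).2, hv.2.2⟩⟩⟩

/-- `N(gcd(d₁,d₂)) ≤ ∑_{h ∈ ℤ[i]*, N(h) ≤ y, h ∣ d₁, h ∣ d₂} N(h)` for `d₁, d₂` in `{N ≤ y}` (`q1(gcd)` is one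
of the `h`). [folklore] -/
theorem norm_gcd_le_sum {y : ℝ} {d₁ : _root_.GaussianInt} (d₂ : _root_.GaussianInt) (h₁ : d₁ ∈ normLEStar y) :
    ((EuclideanDomain.gcd d₁ d₂).norm : ℝ) ≤
      ∑ h ∈ (normLEStar y).filter (fun h ↦ h ∣ d₁ ∧ h ∣ d₂), ((h.norm : ℝ)) := by
  set g := EuclideanDomain.gcd d₁ d₂ with hgdef
  have hd₁ := mem_normLEStar.1 h₁
  have hd0 : d₁ ≠ 0 := ne_zero_of_mem_fq hd₁.2
  have hg : g ≠ 0 := fun h ↦ hd0 ((EuclideanDomain.gcd_eq_zero_iff.1 h).1)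
  have hmem : q1 g ∈ (normLEStar y).filter (fun h ↦ h ∣ d₁ ∧ h ∣ d₂) := by
    rw [mem_filter, mem_normLEStar, norm_q1]
    refine ⟨⟨?_, q1_mem hg⟩, (associated_q1 g).dvd.trans (EuclideanDomain.gcd_dvd_left _ _),
      (associated_q1 g).dvd.trans (EuclideanDomain.gcd_dvd_right _ _)⟩
    exact le_trans (by exact_mod_cast norm_le_norm_of_dvd (EuclideanDomain.gcd_dvd_left d₁ d₂) hd0) hd₁.1
  have := single_le_sum (f := fun h : _root_.GaussianInt ↦ ((h.norm : ℝ)))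
    (fun h _ ↦ by exact_mod_cast GaussianInt.norm_nonneg h) hmem
  rwa [norm_q1] at this

/-- `∑_{(d₁,d₂) ∈ {N ≤ y}², h ∣ d₁, h ∣ d₂} (N(d₁)N(d₂))⁻¹ = (∑_{h ∣ d} N(d)⁻¹)²`. [folklore] -/
theorem sum_pairs_filter_dvd_eq (y : ℝ) (h : _root_.GaussianInt) :
    ∑ p ∈ (normLEStar y ×ˢ normLEStar y).filter (fun p ↦ h ∣ p.1 ∧ h ∣ p.2),
        ((p.1.norm : ℝ))⁻¹ * ((p.2.norm : ℝ))⁻¹ =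
      (∑ d ∈ (normLEStar y).filter (fun d ↦ h ∣ d), ((d.norm : ℝ))⁻¹) ^ 2 := by
  have hfil : (normLEStar y ×ˢ normLEStar y).filter (fun p ↦ h ∣ p.1 ∧ h ∣ p.2) =
      (normLEStar y).filter (fun d ↦ h ∣ d) ×ˢ (normLEStar y).filter (fun d ↦ h ∣ d) := by
    ext ⟨a, b⟩
    simp only [mem_filter, mem_product]
    tauto
  rw [hfil, sum_product, sq, sum_mul_sum]

/-- **`∑_{(d₁,d₂) ∈ {N ≤ y}²} N(gcd(d₁,d₂))/(N(d₁)N(d₂)) ≤ 44³ (1 + log y)³`** (`y ≥ 1`). [folklore] -/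
theorem sum_norm_gcd_div_le {y : ℝ} (hy : 1 ≤ y) :
    ∑ p ∈ normLEStar y ×ˢ normLEStar y,
        ((EuclideanDomain.gcd p.1 p.2).norm : ℝ) * (((p.1.norm : ℝ))⁻¹ * ((p.2.norm : ℝ))⁻¹) ≤
      44 ^ 3 * (1 + Real.log y) ^ 3 := by
  set L : ℝ := 1 + Real.log y with hL
  have hL1 : 1 ≤ L := by rw [hL]; linarith [Real.log_nonneg hy]
  -- Step 1: replace `N(gcd)` by the sum over common divisor classes `h`
  have h1 : ∑ p ∈ normLEStar y ×ˢ normLEStar y,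
      ((EuclideanDomain.gcd p.1 p.2).norm : ℝ) * (((p.1.norm : ℝ))⁻¹ * ((p.2.norm : ℝ))⁻¹) ≤
      ∑ p ∈ normLEStar y ×ˢ normLEStar y, ∑ h ∈ (normLEStar y).filter (fun h ↦ h ∣ p.1 ∧ h ∣ p.2),
        ((h.norm : ℝ)) * (((p.1.norm : ℝ))⁻¹ * ((p.2.norm : ℝ))⁻¹) := by
    refine sum_le_sum fun p hp ↦ ?_
    rw [mem_product] at hp
    rw [← sum_mul]
    refine mul_le_mul_of_nonneg_right (norm_gcd_le_sum p.2 hp.1) ?_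
    exact mul_nonneg (inv_nonneg.2 (by exact_mod_cast GaussianInt.norm_nonneg _))
      (inv_nonneg.2 (by exact_mod_cast GaussianInt.norm_nonneg _))
  refine h1.trans ?_
  -- Step 2: swap the sums
  rw [sum_comm' (s' := fun h ↦ (normLEStar y ×ˢ normLEStar y).filter (fun p ↦ h ∣ p.1 ∧ h ∣ p.2))
    (t' := normLEStar y) (fun p h ↦ by
      simp only [mem_filter, mem_product]
      tauto)]
  -- Step 3: each `h`-term is `N(h) (∑_{h ∣ d} N(d)⁻¹)² ≤ 44² L² / N(h)`
  have h3 : ∀ h ∈ normLEStar y, ∑ p ∈ (normLEStar y ×ˢ normLEStar y).filter (fun p ↦ h ∣ p.1 ∧ h ∣ p.2),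
      ((h.norm : ℝ)) * (((p.1.norm : ℝ))⁻¹ * ((p.2.norm : ℝ))⁻¹) ≤ 44 ^ 2 * L ^ 2 * ((h.norm : ℝ))⁻¹ := by
    intro h hh
    have hh0 : h ≠ 0 := ne_zero_of_mem_fq (mem_normLEStar.1 hh).2
    have hNh : (0 : ℝ) < (h.norm : ℝ) := by exact_mod_cast GaussianInt.norm_pos.2 hh0
    rw [← mul_sum, sum_pairs_filter_dvd_eq]
    have hb := sum_inv_norm_filter_dvd_le hy hh0
    have hb0 : 0 ≤ ∑ d ∈ (normLEStar y).filter (fun d ↦ h ∣ d), ((d.norm : ℝ))⁻¹ :=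
      sum_nonneg fun d _ ↦ inv_nonneg.2 (by exact_mod_cast GaussianInt.norm_nonneg d)
    calc (h.norm : ℝ) * (∑ d ∈ (normLEStar y).filter (fun d ↦ h ∣ d), ((d.norm : ℝ))⁻¹) ^ 2
        ≤ (h.norm : ℝ) * (44 * L / (h.norm : ℝ)) ^ 2 := by
          refine mul_le_mul_of_nonneg_left (pow_le_pow_left₀ hb0 hb 2) hNh.le
      _ = 44 ^ 2 * L ^ 2 * ((h.norm : ℝ))⁻¹ := by field_simp
  refine (sum_le_sum h3).trans ?_
  rw [← mul_sum]
  calc 44 ^ 2 * L ^ 2 * ∑ h ∈ normLEStar y, ((h.norm : ℝ))⁻¹ ≤ 44 ^ 2 * L ^ 2 * (44 * L) :=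
        mul_le_mul_of_nonneg_left (sum_inv_norm_le hy) (by positivity)
    _ = 44 ^ 3 * L ^ 3 := by ring

/-- **The second moment of `τ⋆` over `ℤ[i]*`:**
`∑_{v ∈ ℤ[i]*, N(v) ≤ y} τ⋆(v)² ≤ 766656 · y (1 + log y)³` (`y ≥ 1`; `766656 = 9 · 44³`). [folklore] -/
theorem sum_card_divisorsStar_sq_le {y : ℝ} (hy : 1 ≤ y) :
    ∑ v ∈ normLEStar y, ((divisorsStar v).card : ℝ) ^ 2 ≤ 766656 * y * (1 + Real.log y) ^ 3 := by
  rw [sum_card_divisorsStar_sq_eq]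
  have hy0 : 0 ≤ y := by linarith
  have h1 : ∀ p ∈ normLEStar y ×ˢ normLEStar y,
      ((((normLEStar y).filter (fun v ↦ p.1 ∣ v ∧ p.2 ∣ v)).card : ℝ)) ≤
        9 * y * (((EuclideanDomain.gcd p.1 p.2).norm : ℝ) * (((p.1.norm : ℝ))⁻¹ * ((p.2.norm : ℝ))⁻¹)) := by
    intro p hp
    rw [mem_product] at hp
    have h10 : p.1 ≠ 0 := ne_zero_of_mem_fq (mem_normLEStar.1 hp.1).2
    have h20 : p.2 ≠ 0 := ne_zero_of_mem_fq (mem_normLEStar.1 hp.2).2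
    refine (card_filter_dvd_dvd_le h10 h20 hy0).trans (le_of_eq ?_)
    rw [div_eq_mul_inv, mul_inv]
    ring
  calc ∑ p ∈ normLEStar y ×ˢ normLEStar y, ((((normLEStar y).filter (fun v ↦ p.1 ∣ v ∧ p.2 ∣ v)).card : ℝ))
      ≤ ∑ p ∈ normLEStar y ×ˢ normLEStar y,
          9 * y * (((EuclideanDomain.gcd p.1 p.2).norm : ℝ) * (((p.1.norm : ℝ))⁻¹ * ((p.2.norm : ℝ))⁻¹)) :=
        sum_le_sum h1
    _ = 9 * y * ∑ p ∈ normLEStar y ×ˢ normLEStar y,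
          ((EuclideanDomain.gcd p.1 p.2).norm : ℝ) * (((p.1.norm : ℝ))⁻¹ * ((p.2.norm : ℝ))⁻¹) := by
        rw [mul_sum]
    _ ≤ 9 * y * (44 ^ 3 * (1 + Real.log y) ^ 3) :=
        mul_le_mul_of_nonneg_left (sum_norm_gcd_div_le hy) (by positivity)
    _ = 766656 * y * (1 + Real.log y) ^ 3 := by ring

/-! ### The content -/

/-- `v = g(v) · v₀` with `v₀ = (re v / g, im v / g)`. [folklore] -/
theorem eq_content_mul (v : _root_.GaussianInt) :
    v = (GaussianInt.content v : _root_.GaussianInt) * ⟨v.re / GaussianInt.content v, v.im / GaussianInt.content v⟩ := by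
  have hdre : ((GaussianInt.content v : ℕ) : ℤ) ∣ v.re := Int.gcd_dvd_left ..
  have hdim : ((GaussianInt.content v : ℕ) : ℤ) ∣ v.im := Int.gcd_dvd_right ..
  rw [show ((GaussianInt.content v : _root_.GaussianInt)) = (((GaussianInt.content v : ℕ) : ℤ) : _root_.GaussianInt)
    by simp, Zsqrtd.intCast_val]
  ext
  · simp [Int.mul_ediv_cancel' hdre]
  · simp [Int.mul_ediv_cancel' hdim]

/-- The points of `ℤ[i]* ∩ {N ≤ y}` of content `e ≥ 1` number at most `9y/e²` (`v ↦ v/e`). [folklore] -/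
theorem card_filter_content_eq_le {y : ℝ} (hy : 0 ≤ y) {e : ℕ} (he : 1 ≤ e) :
    ((((normLEStar y).filter (fun v ↦ GaussianInt.content v = e)).card : ℝ)) ≤ 9 * y / (e : ℝ) ^ 2 := by
  have he0 : (0 : ℝ) < e := by exact_mod_cast he
  rw [le_div_iff₀ (by positivity)]
  have hcard : ((normLEStar y).filter (fun v ↦ GaussianInt.content v = e)).card ≤ (normLEStar (y / (e : ℝ) ^ 2)).card := by
    refine card_le_card_of_injOn (fun v ↦ (⟨v.re / e, v.im / e⟩ : _root_.GaussianInt)) ?_ ?_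
    · intro v hv
      rw [mem_coe, mem_filter, mem_normLEStar] at hv
      obtain ⟨⟨hvy, hvq⟩, hve⟩ := hv
      have hdec := eq_content_mul v
      rw [hve] at hdec
      set v₀ : _root_.GaussianInt := ⟨v.re / e, v.im / e⟩ with hv₀
      have hnorm : ((e : ℤ)) ^ 2 * v₀.norm = v.norm := by
        conv_rhs => rw [hdec]
        rw [norm_natCast_mul]
      rw [mem_coe, mem_normLEStar]
      constructor
      · rw [le_div_iff₀ (by positivity)]
        have : (v₀.norm : ℝ) * (e : ℝ) ^ 2 = (v.norm : ℝ) := by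
          have := congrArg (fun z : ℤ ↦ (z : ℝ)) hnorm
          push_cast at this
          linarith
        linarith
      · -- `v₀ ∈ ℤ[i]*`: `v = e v₀` with `e ≥ 1`
        rw [mem_firstQuadrant] at hvq ⊢
        have hre : v.re = (e : ℤ) * v₀.re := by
          have := congrArg Zsqrtd.re hdec
          rw [(natCast_mul_re_im e v₀).1] at this; exact this
        have him : v.im = (e : ℤ) * v₀.im := by
          have := congrArg Zsqrtd.im hdec
          rw [(natCast_mul_re_im e v₀).2] at this; exact this
        have he' : (0 : ℤ) < e := by exact_mod_cast he
        constructor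
        · by_contra hc; rw [not_lt] at hc; nlinarith [hvq.1]
        · by_contra hc; rw [not_le] at hc; nlinarith [hvq.2]
    · intro v hv v' hv' heq
      rw [mem_coe, mem_filter] at hv hv'
      have h1 := eq_content_mul v
      have h2 := eq_content_mul v'
      rw [hv.2] at h1
      rw [hv'.2] at h2
      have heq' : (⟨v.re / e, v.im / e⟩ : _root_.GaussianInt) = ⟨v'.re / e, v'.im / e⟩ := heq
      rw [h1, h2, heq']
  calc ((((normLEStar y).filter (fun v ↦ GaussianInt.content v = e)).card : ℝ)) * (e : ℝ) ^ 2
      ≤ (normLEStar (y / (e : ℝ) ^ 2)).card * (e : ℝ) ^ 2 := by gcongr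
    _ ≤ 9 * (y / (e : ℝ) ^ 2) * (e : ℝ) ^ 2 := by
        gcongr; exact card_normLEStar_le (by positivity)
    _ = 9 * y := by field_simp

/-- **`∑_{v ∈ ℤ[i]*, N(v) ≤ y} g(v) ≤ 9 y (1 + log y)`** (`y ≥ 1`). [folklore] -/
theorem sum_content_le {y : ℝ} (hy : 1 ≤ y) :
    ∑ v ∈ normLEStar y, (GaussianInt.content v : ℝ) ≤ 9 * y * (1 + Real.log y) := by
  have hy0 : 0 ≤ y := by linarith
  -- fibre by the content, which lies in `[1, ⌊y⌋]`
  have hmaps : ∀ v ∈ normLEStar y, GaussianInt.content v ∈ Icc 1 ⌊y⌋₊ := by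
    intro v hv
    rw [mem_normLEStar] at hv
    have hv0 := hv.2
    rw [mem_firstQuadrant] at hv0
    have hcpos : 0 < GaussianInt.content v := Int.gcd_pos_of_ne_zero_left _ hv0.1.ne'
    rw [mem_Icc]
    refine ⟨hcpos, Nat.le_floor ?_⟩
    -- `content v ≤ content v ^ 2 ≤ N(v) ≤ y`
    have hdec := eq_content_mul v
    set v₀ : _root_.GaussianInt := ⟨v.re / GaussianInt.content v, v.im / GaussianInt.content v⟩
    have hnorm : ((GaussianInt.content v : ℤ)) ^ 2 * v₀.norm = v.norm := by
      conv_rhs => rw [hdec]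
      rw [norm_natCast_mul]
    have hv₀0 : v₀ ≠ 0 := by
      intro h0
      rw [h0, mul_zero] at hdec
      exact ne_zero_of_mem_fq hv.2 hdec
    have hN₀ : 1 ≤ v₀.norm := by have := GaussianInt.norm_pos.2 hv₀0; omega
    have hc1 : (1 : ℤ) ≤ GaussianInt.content v := by exact_mod_cast hcpos
    have : (GaussianInt.content v : ℤ) ≤ v.norm := by nlinarith
    calc (GaussianInt.content v : ℝ) = ((GaussianInt.content v : ℤ) : ℝ) := by norm_cast
      _ ≤ (v.norm : ℝ) := by exact_mod_cast this
      _ ≤ y := hv.1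
  rw [← sum_fiberwise_of_maps_to hmaps]
  have hfib : ∀ e ∈ Icc 1 ⌊y⌋₊, ∑ v ∈ (normLEStar y).filter (fun v ↦ GaussianInt.content v = e),
      (GaussianInt.content v : ℝ) ≤ 9 * y * ((e : ℝ))⁻¹ := by
    intro e he
    rw [mem_Icc] at he
    have he0 : (0 : ℝ) < e := by exact_mod_cast he.1
    have h1 : ∑ v ∈ (normLEStar y).filter (fun v ↦ GaussianInt.content v = e), (GaussianInt.content v : ℝ) =
        (((normLEStar y).filter (fun v ↦ GaussianInt.content v = e)).card : ℝ) * e := by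
      rw [sum_congr rfl (fun v hv ↦ by rw [(mem_filter.1 hv).2] :
        ∀ v ∈ (normLEStar y).filter (fun v ↦ GaussianInt.content v = e), (GaussianInt.content v : ℝ) = (e : ℝ)),
        sum_const, nsmul_eq_mul]
    rw [h1]
    calc (((normLEStar y).filter (fun v ↦ GaussianInt.content v = e)).card : ℝ) * e
        ≤ 9 * y / (e : ℝ) ^ 2 * e := mul_le_mul_of_nonneg_right (card_filter_content_eq_le hy0 he.1) he0.le
      _ = 9 * y * ((e : ℝ))⁻¹ := by field_simp
  refine (sum_le_sum hfib).trans ?_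
  rw [← mul_sum]
  refine mul_le_mul_of_nonneg_left ?_ (by positivity)
  -- harmonic bound
  have hh := harmonic_le_one_add_log ⌊y⌋₊
  rw [harmonic_eq_sum_Icc] at hh
  push_cast at hh
  have hlog : Real.log (⌊y⌋₊ : ℝ) ≤ Real.log y :=
    Real.log_le_log (by exact_mod_cast Nat.floor_pos.2 hy) (Nat.floor_le hy0)
  linarith

end GaussianHecke

end Literature.NumberTheory.LFunctions
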